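import Literature.AlgebraicGeometry.HodgeTheory.InvariantClassesFromTotalSpaceLefschetzClass
import HarnessLib

/-!
# Deligne's invariant cycle theorem for a smooth proper morphism with a fibrewise Lefschetz class

Family `hodge`, layer `Literature/AlgebraicGeometry/HodgeTheory`. PROOF FILE (theorems only; no
definition, no named fact — D-0026). Companion of `InvariantClassesFromTotalSpaceLefschetzClass`,
whose `invariantCycles_of_lefschetzClass` proves Voisin II Thm. 4.18 (Deligne 1968) in the generality
of Voisin's Remark 4.16 — an arbitrary class `η ∈ H²(𝒳(ℂ); ℂ)` with the hard Lefschetz property on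
every fibre — but for a family `f : 𝒳 ⟶ S` packaged as `Motives.IsSmoothProjectiveFamily f n₀`, i.e.
with GEOMETRICALLY IRREDUCIBLE fibres. A smooth projective morphism in the printed sense (Voisin II
Def. 4.14: `𝒳 ↪ S × ℙᵐ` closed over `S`, `f` smooth) has smooth projective fibres which may be
reducible or empty. What the proof uses of the fibres is only: `f(ℂ)` is a Serre fibration (true
for every smooth proper `f`, `Motives.isSerreFibration_map_of_smooth_proper`), the hard Lefschetz
property of `η|_{𝒳_s}` in a fixed dimension `n₀`, and the vanishing of `Hₖ(𝒳_s(ℂ); ℂ)` for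
`k > 2n₀`. This file records the theorem in exactly that form:

* `invariantCycles_of_lefschetzClass_of_smooth_proper` — for `f` smooth and proper over a smooth
  separated quasi-compact `S`, `η ∈ H²(𝒳(ℂ); ℂ)` with `η|_{𝒳_s}` hard Lefschetz in dimension `n₀` and
  `Hₖ(𝒳_s(ℂ); ℂ) = 0` for `k > 2n₀` at every complex point `s`, every flat section of `Rᵏ f(ℂ)_* ℚ`
  is the family of restrictions of one class of `Hᵏ(𝒳(ℂ); ℚ)`.

The proof is that of `invariantCycles_of_lefschetzClass` verbatim (Serre fibration, the scheme
fibres are the topological fibres, cap-product form of hard Lefschetz, Deligne's degeneration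
criterion `SerreInvariantCycles.exists_class_of_flat_of_cover` over the equidimensional pieces of
`S(ℂ)`, descent of coefficients along a `ℚ`-linear retraction of `ℚ ⊆ ℂ`). It is the per-piece step
of the discharge of the named fact `Motives.Voisin2003_invariantCycles` (applied to the open and
closed pieces of `𝒳` on which `f` has constant relative dimension).

## References

* [VoisinHodgeII2003] C. Voisin, Hodge Theory and Complex Algebraic Geometry II (CUP 2003), Def. 4.14,
  Thm. 4.15, Rem. 4.16, Lemma 4.17, Thm. 4.18 (pp. 124–126).
* [Deligne1968] P. Deligne, Théorème de Lefschetz et critères de dégénérescence de suites spectrales,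
  Publ. Math. IHÉS 35 (1968), Thm. 1.5, Prop. 2.1.
* [HatcherAT2002] A. Hatcher, Algebraic Topology (CUP 2002), §3.1, Prop. 3.10, §4.2 Prop. 4.48.
-/

noncomputable section

open CategoryTheory AlgebraicGeometry Filter TopologicalSpace Set Function
open scoped Manifold ContDiff Topology
open Literature.AlgebraicTopology.SingularHomology
open Literature.AlgebraicTopology.Homotopy
open Literature.Algebra.Homology Literature.Geometry.Kaehler

namespace Literature.AlgebraicGeometry.HodgeTheory

open _root_.Topology
open Literature.AlgebraicGeometry.Motives

section Family

variable {𝒳 S : Motives.SchemeOver ℂ} (f : 𝒳 ⟶ S)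

/-- A `ℚ`-linear retraction of `ℚ ⊆ ℂ` (local copy of the private lemma of
`InvariantClassesFromTotalSpaceHolds`). [folklore] -/
private theorem exists_dual_apply_one₃ : ∃ g : ℂ →ₗ[ℚ] ℚ, g 1 = 1 := by
  obtain ⟨g₀, hg₀⟩ : ∃ g₀ : Module.Dual ℚ ℂ, g₀ 1 ≠ 0 := by
    by_contra h
    push Not at h
    exact one_ne_zero ((Module.forall_dual_apply_eq_zero_iff ℚ (1 : ℂ)).1 h)
  exact ⟨(g₀ 1)⁻¹ • g₀, by rw [LinearMap.smul_apply, smul_eq_mul, inv_mul_cancel₀ hg₀]⟩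

/-- **Deligne's invariant cycle theorem for a smooth proper morphism with a fibrewise Lefschetz
class** (Deligne 1968, Thm. 1.5 / Prop. 2.1; Voisin II Thm. 4.18 in the generality of Remark 4.16,
`ℚ`-statement, fibres possibly reducible or empty). Let `f : 𝒳 ⟶ S` be smooth and proper over a
smooth separated quasi-compact `ℂ`-scheme `S`, `n₀ : ℕ`, and `η ∈ H²(𝒳(ℂ); ℂ)` a class such that for
every complex point `s` the restriction `η|_{𝒳_s}` has the hard Lefschetz property in dimension `n₀`
and `Hₖ(𝒳_s(ℂ); ℂ) = 0` for `k > 2n₀`. Then every flat section `y` of `Rᵏ f(ℂ)_* ℚ` is the family of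
restrictions of one class `z ∈ Hᵏ(𝒳(ℂ); ℚ)`. The proof of `invariantCycles_of_lefschetzClass`
verbatim, the two uses of `IsSmoothProjectiveFamily` (properness/smoothness of `f`, top vanishing on
the fibres) being the present hypotheses.
[cite: VoisinHodgeII2003, Thm. 4.18 with Thm. 4.15 and Remark 4.16]
[cite: Deligne1968, Thm. 1.5 and Prop. 2.1] -/
theorem invariantCycles_of_lefschetzClass_of_smooth_proper (n₀ : ℕ)
    [Smooth S.hom] [IsSeparated S.hom] [CompactSpace S.left] [Smooth f.left] [IsProper f.left]
    (η : complexBetti 𝒳 2)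
    (hη : ∀ s : Motives.ComplexPoints S,
      HasHardLefschetzProperty (complexBetti.map (Motives.fiberι f s) 2 η) n₀)
    (hvan₀ : ∀ (s : Motives.ComplexPoints S) (k : ℕ), 2 * n₀ < k →
      Limits.IsZero (singularHomology ℂ ℂ (Motives.ComplexPoints (Motives.fiberOver f s)) k))
    (k : ℕ) (y : ∀ s : Motives.ComplexPoints S, Motives.bettiCohomology (Motives.fiberOver f s) k)
    (hy : Motives.IsFlatSection f k y) :
    ∃ z : Motives.bettiCohomology 𝒳 k,
      ∀ s, (Motives.bettiCohomology.map (Motives.fiberι f s) k).hom z = y s := by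
  classical
  haveI : LocallyOfFiniteType S.hom := inferInstance
  haveI : IsSeparated 𝒳.hom := by rw [← Over.w f]; infer_instance
  haveI : T2Space (ComplexPoints 𝒳) := ComplexPoints.t2Space_of_isSeparated 𝒳
  have hp : IsSerreFibration (AlgPoints.map f : ComplexPoints 𝒳 → ComplexPoints S) :=
    isSerreFibration_map_of_smooth_proper f
  -- the topological fibres are the scheme-theoretic fibres
  have he : ∀ s : ComplexPoints S, ∃ e : ComplexPoints (fiberOver f s) ≃ₜ
      ↥((AlgPoints.map f : ComplexPoints 𝒳 → ComplexPoints S) ⁻¹' {s}),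
      ∀ x, ((e x : ↥((AlgPoints.map f : ComplexPoints 𝒳 → ComplexPoints S) ⁻¹' {s})) :
        ComplexPoints 𝒳) = AlgPoints.map (fiberι f s) x := fun s => exists_fiberHomeomorph f s
  choose e he using he
  have hefac : ∀ s, (subsetIncl ((AlgPoints.map f : ComplexPoints 𝒳 → ComplexPoints S) ⁻¹' {s})).comp
      (e s : C(ComplexPoints (fiberOver f s), ↥((AlgPoints.map f : ComplexPoints 𝒳 → ComplexPoints S) ⁻¹' {s}))) =
      AlgPoints.mapContinuous (L := ℂ) (fiberι f s) := fun s => ContinuousMap.ext (he s)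
  -- hard Lefschetz on the fibres `𝒳_s(ℂ)` (cup product): the hypothesis
  have hHLs : ∀ s : ComplexPoints S, HasHardLefschetzProperty
      (singularCohomology.map ℂ ℂ (AlgPoints.mapContinuous (L := ℂ) (fiberι f s)) 2 η) n₀ := hη
  -- hard Lefschetz on the topological fibres (cap product)
  have hHL : ∀ (b : ComplexPoints S) (lo i : ℕ), lo + i = n₀ → i ≤ n₀ →
      Bijective (iterDown
        (V := fun k => singularHomology ℂ ℂ ↥((AlgPoints.map f : ComplexPoints 𝒳 → ComplexPoints S) ⁻¹' {b}) k)
        (fun k => capProduct (show 2 + k = k + 2 by omega)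
          (singularCohomology.map ℂ ℂ
            (subsetIncl ((AlgPoints.map f : ComplexPoints 𝒳 → ComplexPoints S) ⁻¹' {b})) 2 η)) i lo) := by
    intro b lo i hloi _
    refine SerreInvariantCycles.capHardLefschetz_of_hasHardLefschetzProperty ℂ _ ?_ lo i hloi
    rw [← hasHardLefschetzProperty_map_homeomorph_iff (e b) _ n₀, ← ModuleCat.comp_apply,
      ← singularCohomology.map_comp, hefac b]
    exact hHLs b
  -- no fibre homology above degree `2 n₀`
  have hvan : ∀ (b : ComplexPoints S) (k : ℕ), 2 * n₀ < k →
      ∀ c : singularHomology ℂ ℂ ↥((AlgPoints.map f : ComplexPoints 𝒳 → ComplexPoints S) ⁻¹' {b}) k,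
        c = 0 := by
    intro b k hk c
    haveI := ModuleCat.subsingleton_of_isZero (hvan₀ b k hk)
    haveI := isIso_singularHomology_map_of_isWeakHomotopyEquiv ℂ _
      (IsWeakHomotopyEquiv.of_homeomorph (e b).symm) k
    apply (SerreFlat.bijective_hom_of_isIso (singularHomology.map ℂ ℂ
      ((e b).symm : C(↥((AlgPoints.map f : ComplexPoints 𝒳 → ComplexPoints S) ⁻¹' {b}),
        ComplexPoints (fiberOver f b))) k)).1
    exact Subsingleton.elim _ _
  -- the complexified family on the topological fibres, and its flatness
  let y' : ∀ b : ComplexPoints S,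
      singularCohomology ℂ ℂ ↥((AlgPoints.map f : ComplexPoints 𝒳 → ComplexPoints S) ⁻¹' {b}) k :=
    fun b => singularCohomology.map ℂ ℂ
      ((e b).symm : C(↥((AlgPoints.map f : ComplexPoints 𝒳 → ComplexPoints S) ⁻¹' {b}),
        ComplexPoints (fiberOver f b))) k
      (singularCohomology.ringChange (algebraMap ℚ ℂ) (ComplexPoints (fiberOver f b)) k (y b))
  have hy' : ∀ b₀ : ComplexPoints S, ∃ V ∈ 𝓝 b₀,
      ∃ g : singularCohomology ℂ ℂ ↥((AlgPoints.map f : ComplexPoints 𝒳 → ComplexPoints S) ⁻¹' V) k,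
        ∀ (b : ComplexPoints S) (hb : b ∈ V),
          singularCohomology.map ℂ ℂ (subsetInclusion (SerreFlat.fibre_subset_preimage hb)) k g =
            y' b := by
    intro b₀
    obtain ⟨V, hV, g, hg⟩ := hy b₀
    obtain ⟨e₃, he₃⟩ := exists_tubeHomeomorph f V
    refine ⟨V, hV, singularCohomology.map ℂ ℂ
      (e₃.symm : C(↥((AlgPoints.map f : ComplexPoints 𝒳 → ComplexPoints S) ⁻¹' V), Motives.tube f V)) k
      (singularCohomology.ringChange (algebraMap ℚ ℂ) (Motives.tube f V) k g), fun b hb => ?_⟩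
    have hfac : (e₃.symm : C(↥((AlgPoints.map f : ComplexPoints 𝒳 → ComplexPoints S) ⁻¹' V), Motives.tube f V)).comp
        (subsetInclusion (SerreFlat.fibre_subset_preimage hb)) =
        (Motives.fiberToTube f V b hb).comp
          ((e b).symm : C(↥((AlgPoints.map f : ComplexPoints 𝒳 → ComplexPoints S) ⁻¹' {b}),
            ComplexPoints (fiberOver f b))) := by
      refine ContinuousMap.ext fun v => Subtype.ext ?_
      have h1 := he₃ (e₃.symm (subsetInclusion (SerreFlat.fibre_subset_preimage hb) v))
      rw [Homeomorph.apply_symm_apply] at h1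
      have h2 := he b ((e b).symm v)
      rw [Homeomorph.apply_symm_apply] at h2
      change ((e₃.symm (subsetInclusion (SerreFlat.fibre_subset_preimage hb) v) : Motives.tube f V) :
          ComplexPoints 𝒳) = AlgPoints.map (fiberι f b) ((e b).symm v)
      rw [← h2, ← h1]
      rfl
    rw [← ModuleCat.comp_apply, ← singularCohomology.map_comp, hfac, singularCohomology.map_comp,
      ModuleCat.comp_apply, ← ringChange_map]
    change _ = singularCohomology.map ℂ ℂ
      ((e b).symm : C(↥((AlgPoints.map f : ComplexPoints 𝒳 → ComplexPoints S) ⁻¹' {b}),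
        ComplexPoints (fiberOver f b))) k
      (singularCohomology.ringChange (algebraMap ℚ ℂ) (ComplexPoints (fiberOver f b)) k (y b))
    rw [← hg b hb]
    rfl
  -- the base pieces and the topological theorem over `ℂ`
  obtain ⟨Bp, hBo, hBd, hBc, hCW⟩ := exists_cover_cwModels S
  obtain ⟨z', hz'⟩ := SerreInvariantCycles.exists_class_of_flat_of_cover ℂ hp Bp hBo hBd hBc hCW
    η hHL hvan y' hy'
  have hres : ∀ s, singularCohomology.map ℂ ℂ (AlgPoints.mapContinuous (L := ℂ) (fiberι f s)) k z' =
      singularCohomology.ringChange (algebraMap ℚ ℂ) (ComplexPoints (fiberOver f s)) k (y s) := by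
    intro s
    rw [← hefac s, singularCohomology.map_comp, ModuleCat.comp_apply, hz' s]
    exact SerreFlat.map_homeomorph_map_symm ℂ (e s) k _
  -- descent of coefficients along a `ℚ`-linear retraction of `ℚ ⊆ ℂ`
  obtain ⟨g, hg1⟩ := exists_dual_apply_one₃
  refine ⟨singularCohomology.mapCoeff (ComplexPoints 𝒳) g k
    (singularCohomology.scalarChange ℂ ℚ ℂ (ComplexPoints 𝒳) k z'), fun s => ?_⟩
  change singularCohomology.map ℚ ℚ (AlgPoints.mapContinuous (L := ℂ) (fiberι f s)) k _ = y s
  rw [← mapCoeff_scalarChange_map, hres s]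
  have h1 := mapCoeff_scalarChange_smul_ringChange ℚ g (1 : ℂ) (y s)
  rw [one_smul, hg1, one_smul] at h1
  exact h1

end Family

end Literature.AlgebraicGeometry.HodgeTheory

end
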